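import Mathlib
import Summits.PneNP.PneNP.Theorems.CnfIdealGenLengthRankDefectRepresentationsSimReduction

/-!
# Crux `RankDefectRepresentations` (stmt-PneNP-18923), line `rank-dehn-ladder`: MONOTONICITY OF SIM
# (registered stub `stub_simBoundMono`, RESHAPE 5, lead g9)

`SimBound K κ C` (`Theorems/…SimReduction`, p652532) transfers from a coordinate type `κ'` to every `κ` that embeds into `κ'`, and the
constant may be enlarged: extend a `κ`-instance to `κ'` by giving the dummy coordinates the colour `false` on every row and column (their
cuts are empty) and the data `0`; the hypotheses of `SimBound` survive (`Function.extend` along the embedding), and the glued matrix for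
the `κ'`-instance works for the `κ`-instance.  With `stub_simBoundQuasiPoly` this turns the `2^k`-coordinate quasi-polynomial bound into one
for every `n` (`simBound_quasiPoly_of_stubs` in the line's skeleton).
HONEST FRAMING: bookkeeping; P ≠ NP is not moved; F-N2 is a FRONTIER formal rung.
-/

set_option linter.dupNamespace false -- `Summit.PneNP.PneNP.…`: summit = sub-problem name (D-0017)

namespace Summit.PneNP.PneNP.Theorems.CnfIdealGenLengthRankDefectRepresentationsSimBoundMono

open Matrix
open Summit.PneNP.PneNP.Theorems.CnfIdealGenLengthRankDefectRepresentationsSimReduction (cut SimBound)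

variable {K : Type} [Field K]

section Extend

variable {ι ι' κ κ' : Type} (f : κ ↪ κ') (row : ι → κ → Bool) (col : ι' → κ → Bool)

/-- On a coordinate in the image of the embedding, the extended colourings give the original cut. -/
theorem cut_extend_apply (k : κ) (M : Matrix ι ι' K) :
    cut (fun x => Function.extend f (row x) (fun _ => false)) (fun y => Function.extend f (col y) (fun _ => false)) (f k) M
      = cut row col k M := by
  ext x y
  simp only [cut, Matrix.of_apply, f.injective.extend_apply]

/-- Off the image of the embedding, the extended colourings are `false` on rows and columns, so the cut is empty. -/
theorem cut_extend_of_not_mem (k' : κ') (hk' : ¬ ∃ k, f k = k') (M : Matrix ι ι' K) :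
    cut (fun x => Function.extend f (row x) (fun _ => false)) (fun y => Function.extend f (col y) (fun _ => false)) k' M = 0 := by
  ext x y
  simp only [cut, Matrix.of_apply, Function.extend_apply' _ _ _ hk', ne_eq, not_true_eq_false, Matrix.zero_apply,
    ite_eq_right_iff]
  intro h; exact h.elim

end Extend

/-- **Registered stub `stub_simBoundMono`** (line `rank-dehn-ladder`, RESHAPE 5): `SimBound` is monotone in the coordinate type (along
embeddings) and in the constant. -/
theorem stub_simBoundMono :
    ∀ (K : Type) [Field K] (κ κ' : Type) (C C' : ℕ), Nonempty (κ ↪ κ') → C ≤ C' →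
      Summit.PneNP.PneNP.Theorems.CnfIdealGenLengthRankDefectRepresentationsSimReduction.SimBound K κ' C →
      Summit.PneNP.PneNP.Theorems.CnfIdealGenLengthRankDefectRepresentationsSimReduction.SimBound K κ C' := by
  intro K _ κ κ' C C' hf hle h
  obtain ⟨f⟩ := hf
  intro ι ι' _ _ _ _ row col y t hsupp hcons
  classical
  -- the extended instance on `κ'`
  set row' : ι → κ' → Bool := fun x => Function.extend f (row x) (fun _ => false) with hrow'
  set col' : ι' → κ' → Bool := fun x => Function.extend f (col x) (fun _ => false) with hcol'
  set y' : κ' → Matrix ι ι' K := Function.extend f y (fun _ => 0) with hy'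
  have hin : ∀ k (M : Matrix ι ι' K), cut row' col' (f k) M = cut row col k M :=
    fun k M => cut_extend_apply f row col k M
  have hout : ∀ k', (¬ ∃ k, f k = k') → ∀ M : Matrix ι ι' K, cut row' col' k' M = 0 :=
    fun k' hk' M => cut_extend_of_not_mem f row col k' hk' M
  have hy_in : ∀ k, y' (f k) = y k := fun k => f.injective.extend_apply _ _ _
  have hy_out : ∀ k', (¬ ∃ k, f k = k') → y' k' = 0 := fun k' hk' => Function.extend_apply' _ _ _ hk'
  have hsupp' : ∀ k', cut row' col' k' (y' k') = y' k' := by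
    intro k'
    by_cases hk' : ∃ k, f k = k'
    · obtain ⟨k, rfl⟩ := hk'
      rw [hy_in, hin]; exact hsupp k
    · rw [hy_out k' hk', hout k' hk']
  have hcons' : ∀ k' l', (cut row' col' k' (cut row' col' l' (y' k' - y' l'))).rank ≤ t := by
    intro k' l'
    by_cases hk' : ∃ k, f k = k'
    · obtain ⟨k, rfl⟩ := hk'
      by_cases hl' : ∃ l, f l = l'
      · obtain ⟨l, rfl⟩ := hl'
        rw [hy_in, hy_in, hin, hin]; exact hcons k l
      · rw [hout l' hl', show cut row' col' (f k) (0 : Matrix ι ι' K) = 0 from ?_, Matrix.rank_zero]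
        · exact Nat.zero_le _
        · ext x z; simp [cut]
    · rw [hout k' hk', Matrix.rank_zero]; exact Nat.zero_le _
  obtain ⟨z, hz⟩ := h ι ι' row' col' y' t hsupp' hcons'
  refine ⟨z, fun k => ?_⟩
  have := hz (f k)
  rw [hy_in, hin] at this
  exact this.trans (Nat.mul_le_mul_right _ hle)

end Summit.PneNP.PneNP.Theorems.CnfIdealGenLengthRankDefectRepresentationsSimBoundMono
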